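import Summits.PneNP.PneNP.Theorems.ChebyshevTracialDesignDipoleHitBound
import Literature.Combinatorics.AssociationSchemes.JohnsonSpectrum
import HarnessLib

/-!
# Cell pnp-psdrank, route `ChebyshevTracialDesign`: the dipole hit bound as a bound on every even layer eigenvalue of
# every level Gram kernel (uniform-in-the-level attenuation, lit's `kernelEigen` currency)

Harmonic backbone of the `r = 1` rung of the crux `TracialDecayExp20` (stmt-PneNP-19878). The square-sum bound
`…DipoleHitBound.sum_sq_level_dipole_sum_le` (this seat) turned into the literature seat's eigenvalue currency by
`Literature.Combinatorics.AssociationSchemes.JohnsonSpectrum.kernelEigen_le_iff_dipole_gram` (a layer bound ⟺ one quadratic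
form for ONE dipole test vector) together with `ladder_apply_eq_factorial_mul_zeta` and `zeta_dipoleVec`
[cite: Filmus2016, Lemma 2.3 (arXiv p. 5)] [cite: MacWilliamsSloane1977, Ch. 21 §6 Thm. 10 (PDF p. 516)]:
* `kernelEigen_level_le_of_hit` : for `2κ ≤ t ≤ n/2`, dipoles `a, b : Fin (2κ) → Fin n` (injective, disjoint ranges), a level
  `c`, the level incidence `A_c(U,M) = 1[#cr(U,M) = c]` with ANY Gram class function `k` on the `t`-sets (hypothesis `hA`, the
  consumer's `card_jointLevel`-type lemma) and any bound `B` on the size of the level classes: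
  `kernelEigen n t (2κ) k ≤ ((t−2κ)!)² · B² · C(4κ,2κ) · pm(2κ) · pm(n−2κ) / ((Π_{i<t−2κ} ladder n (2κ) i) · 4^κ)`.
  With `λ₀ = rowCount·colCount` (`kernelEigen_zero_eq_rowSum_mul_colSum`) and `B = colCount(c)` this is eng g6's (B)
  `σ_{2κ}(c)² ≤ P_M[all dipoles hit]/E_U[φ²]`, uniformly in `c` — the (ATT) shape `(O(κ)/n)^κ` with an inessential
  constant; prover g5's (★★) is the exact value at the tight level `c = 1`.
WHAT THIS IS NOT: not (L2)/SNT, nothing on psd rank; constants not optimised. Supports crux stmt-PneNP-19878.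
-/

set_option linter.dupNamespace false -- `Summit.PneNP.PneNP.…`: summit = sub-problem (D-0017)

namespace Summit.PneNP.PneNP.Theorems.ChebyshevTracialDesignDipoleHitEigen

open Finset Literature.Barriers.PneNP Literature.Combinatorics.AssociationSchemes
open Literature.Combinatorics.AssociationSchemes.JohnsonHarmonics
open Literature.Combinatorics.AssociationSchemes.JohnsonSpectrum
open Summit.PneNP.PneNP.Theorems.ChebyshevTracialDesignDipoleHitBound

variable {n κ : ℕ} {a b : Fin (2 * κ) → Fin n}

/-- **Every even layer eigenvalue of every level Gram kernel is bounded by the dipole hit count.** For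
`2κ ≤ t ≤ n/2`, injective disjoint dipoles `a, b : Fin (2κ) → Fin n`, a crossing level `c`, a Gram class function `k`
of the level-`c` incidence on the `t`-sets (`hA`) and a bound `B` on the sizes of the level-`c` classes (`hB`):
`kernelEigen n t (2κ) k ≤ ((t−2κ)!)²·B²·C(4κ,2κ)·pm(2κ)·pm(n−2κ) / ((Π_{i<t−2κ} ladder n (2κ) i)·2^{2κ})`.
[cite: Filmus2016, Lemma 2.3 (arXiv p. 5)] -/
theorem kernelEigen_level_le_of_hit {t : ℕ} (hκt : 2 * κ ≤ t) (ht : 2 * t ≤ n)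
    (ha : Function.Injective a) (hb : Function.Injective b) (hab : ∀ i j, a i ≠ b j) (c : ℕ) (k : ℕ → ℝ)
    (hA : ∀ U ∈ univ.powersetCard t, ∀ U' ∈ univ.powersetCard t,
      ∑ M : PMatch n, (if (M.1.filter fun e => cutCount U e = 1).card = c then (1 : ℝ) else 0) *
        (if (M.1.filter fun e => cutCount U' e = 1).card = c then (1 : ℝ) else 0) = k (U ∩ U').card)
    {B : ℝ}
    (hB : ∀ M : PMatch n,
      (((univ.powersetCard t).filter (fun U : Finset (Fin n) => (M.1.filter fun e => cutCount U e = 1).card = c)).card : ℝ) ≤ B) :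
    kernelEigen n t (2 * κ) k ≤
      (((t - 2 * κ).factorial : ℝ)) ^ 2 * B ^ 2 *
          (((4 * κ).choose (2 * κ) * pmCount (2 * κ) * pmCount (n - 2 * κ) : ℕ) : ℝ) /
        ((∏ i ∈ range (t - 2 * κ), ladder n (2 * κ) i) * (2 : ℝ) ^ (2 * κ)) := by
  classical
  have hP : 0 < (∏ i ∈ range (t - 2 * κ), ladder n (2 * κ) i) * (2 : ℝ) ^ (2 * κ) :=
    mul_pos (ladderProd_range_pos hκt ht) (pow_pos two_pos _)
  rw [kernelEigen_le_iff_dipole_gram hκt ht _ k hA ha hb hab, div_mul_cancel₀ _ hP.ne']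
  -- the test vector on the slice is `(t−2κ)! · Π_i ([a_i ∈ U] − [b_i ∈ U])`
  have hφ : ∀ U ∈ univ.powersetCard t, (up^[t - 2 * κ] (dipoleVec (2 * κ) a b)) U =
      ((t - 2 * κ).factorial : ℝ) * ∏ i, ((if a i ∈ U then (1 : ℝ) else 0) - (if b i ∈ U then (1 : ℝ) else 0)) := by
    intro U hU
    rw [ladder_apply_eq_factorial_mul_zeta hκt (isHomog_dipoleVec (2 * κ) a b) (mem_powersetCard.1 hU).2,
      zeta_dipoleVec (2 * κ) a b ha hb hab]
  have hinner : ∀ M : PMatch n,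
      ∑ U ∈ univ.powersetCard t, (up^[t - 2 * κ] (dipoleVec (2 * κ) a b)) U *
          (if (M.1.filter fun e => cutCount U e = 1).card = c then (1 : ℝ) else 0) =
        ((t - 2 * κ).factorial : ℝ) * ∑ U ∈ (univ.powersetCard t).filter
          (fun U : Finset (Fin n) => (M.1.filter fun e => cutCount U e = 1).card = c),
            ∏ i, ((if a i ∈ U then (1 : ℝ) else 0) - (if b i ∈ U then (1 : ℝ) else 0)) := by
    intro M
    rw [sum_filter, mul_sum]
    refine sum_congr rfl fun U hU => ?_
    rw [hφ U hU]
    split_ifs <;> ring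
  simp_rw [hinner, mul_pow, ← mul_sum]
  have hmain := sum_sq_level_dipole_sum_le (n := n) ha hb hab t c hB
  have hf : (0 : ℝ) ≤ (((t - 2 * κ).factorial : ℝ)) ^ 2 := sq_nonneg _
  calc (((t - 2 * κ).factorial : ℝ)) ^ 2 * ∑ M : PMatch n, (∑ U ∈ (univ.powersetCard t).filter
          (fun U : Finset (Fin n) => (M.1.filter fun e => cutCount U e = 1).card = c),
            ∏ i, ((if a i ∈ U then (1 : ℝ) else 0) - (if b i ∈ U then (1 : ℝ) else 0))) ^ 2
      ≤ (((t - 2 * κ).factorial : ℝ)) ^ 2 * (B ^ 2 * (((4 * κ).choose (2 * κ) * pmCount (2 * κ) * pmCount (n - 2 * κ) : ℕ) : ℝ)) :=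
        mul_le_mul_of_nonneg_left hmain hf
    _ = (((t - 2 * κ).factorial : ℝ)) ^ 2 * B ^ 2 *
          (((4 * κ).choose (2 * κ) * pmCount (2 * κ) * pmCount (n - 2 * κ) : ℕ) : ℝ) := by ring

end Summit.PneNP.PneNP.Theorems.ChebyshevTracialDesignDipoleHitEigen
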